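import Mathlib
import HarnessLib
import Literature.Analysis.FluidPDE.KatoLocalBoundedPicard
import Literature.Analysis.FluidPDE.OseenMildUniqueness
import Literature.Analysis.FluidPDE.NSBoundedMildSmoothing
import Literature.Analysis.FluidPDE.KNSSSmoothingHolds
import Literature.Analysis.FluidPDE.PressureNormalisationLq
import Literature.Analysis.FluidPDE.LipschitzSqIntegrableDecay
import Summits.NavierStokesRegularity.NavierStokesRegularity.Theorems.UnthreadedRigidityDoorWindowAnalytic
import Summits.NavierStokesRegularity.NavierStokesRegularity.Theorems.UnthreadedRigidityDoorUnthreadedRigidityThreadingJetsSlice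

/-!
# Route `UnthreadedRigidityDoor`, item `UnthreadedRigidity` (W2, stmt-NavierStokesRegularity-27585) — THREADING JETS, WINDOW:
# the PRESSURE GAUGE of a bounded mild window with `L⁴` slices (toward bridge V-W `VirialWindowSilence` from the slice law)
# (the «M-part» of the window bridge of LINE g11-1 «VIRIAL HORN»; CARD §6–§7, residual R4)

Seat ns-crc-p1 g8 (director-ns dss_142; claimed 07:05Z on the dss bus), `--supports stmt-NavierStokesRegularity-27585 --as helper`.

THE POINT.  Bridge V-W `VirialHorn.VirialWindowSilence` is bridge V at the interior times of a window of the crux: a continuous, divergence-free,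
Oseen-mild, locally bounded, UNTHREADED field `u` on an open time set `S` all of whose slices are admissible separable shells
`u(t) = curl curl (H_t(|y|) Y_t(y) y)`.  Its «M-part» is harder than V's because the window carries NO pressure: one has to manufacture, around
each `t ∈ S`, a classical pressure whose slice at `t` DECAYS AT INFINITY (the gauge in which the slice law `OrderTwoSliceLaw` is stated).  This
file does exactly that, from tree theorems only, for any such window whose slices lie in `L⁴(ℝ³)`:

* `window_L4_strip` — `L⁴` PERSISTENCE near every `t ∈ S` (Oseen fixed point from the bounded `L⁴` datum `u(s₀)` keeps `‖·‖₄ ≤ 2‖u(s₀)‖₄`,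
  `exists_oseen_fixedPoint_bounded`; it IS `u(· + s₀)` by `oseenMild_bounded_unique`);
* `window_knss_bounds` — `∂ₜu(t,·)`, `Du(t)`, `D²u(t)` are bounded at every `t ∈ S` (`knss2009_smoothing_holds`);
* ★ `exists_classical_decaying_pressure` — THE PRESSURE GAUGE: every `t ∈ S` lies in a strip `(s, T₂) ⊆ S` with a classical pressure `p`
  (`IsClassicalNSSolutionOn (Ioo s T₂) 1 0 u p`) such that `p(t) → 0` along `cocompact ℝ³` (FJR `exists_isClassicalNSSolutionOn_Ioo` gives a
  smooth `π`; Tao's normalisation in `L⁴ × L²`, `PressureNormalisation.exists_pressure_ae_eq_rieszPressure_add_const`, gives `π(t) = Q + C` a.e.,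
  `Q ∈ L²`; `∇π(t) = Δu − (u·∇)u − ∂ₜu` is bounded, so `π(t) − C` is Lipschitz and square integrable, hence `→ 0` at infinity,
  `tendsto_cocompact_of_lipschitzWith_of_integrable_sq`; `p := π − C`);
The consequence ★ `virialWindowSilence_of_sliceLaw : OrderTwoSliceLaw → (admissible shells have L⁴ slices) → VirialHorn.VirialWindowSilence`
is filed in `…ThreadingJetsWindowSilence.lean`: after it BOTH slice bridge V (`orderTwoVirialIdentity_of_sliceLaw`) AND window bridge V-W hang on
the ONE explicit-field identity `OrderTwoSliceLaw` (plus the `L⁴` size of shells for V-W).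

HONEST FRAMING: regularity/gauge bookkeeping for HYPOTHETICAL window solutions (local blow-up profiles of the door) — the M-part of one RUNG line's
window bridge; the slice law (L) is NOT proved here; nothing here bears on `UnthreadedRigidity` (27585), the door Target, W2 or Navier–Stokes
regularity; no summit statement is proved.  MODEL/rung work. [folklore]

References: T. Tao, Anal. PDE 6 (2013) = arXiv:1108.1165, Lemma 4.1 (i); G. Koch, N. Nadirashvili, G. Seregin, V. Šverák, Acta Math. 203 (2009)
§4, Prop. 4.1; P. G. Lemarié-Rieusset (CRC 2016) Thm. 5.1, Thm. 9.12; E. Fabes, B. Jones, N. Rivière, ARMA 45 (1972) Thm. 2.1.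
-/

noncomputable section

-- the summit and its single sub-problem share the name (CONVENTIONS §1), as in every Theorems file
set_option linter.dupNamespace false

namespace Summit.NavierStokesRegularity.NavierStokesRegularity.Theorems.UnthreadedRigidity.ThreadingJets

open Set Function Filter Topology MeasureTheory
open scoped RealInnerProductSpace InnerProductSpace ContDiff Laplacian ENNReal NNReal
open Literature.Analysis.FluidPDE
open Literature.Analysis.UnboundedOperators (heatExtension)
open Summit.NavierStokesRegularity.NavierStokesRegularity.Theorems.UnthreadedRigidity.ProfileHorn (E3 threadingFlux)
open Summit.NavierStokesRegularity.NavierStokesRegularity.Theorems.UnthreadedRigidity.VirialHorn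
  (IsSolidHarmonic VirialAdmissible sepShellL virialMoment angForm VirialWindowSilence)

variable {S : Set ℝ} {u : ℝ → E3 → E3}

/-! ### 1. A uniform `L⁴` bound on the slices near every time of the window -/

/-- **`L⁴` persistence near every time of a bounded mild window** (continuous on `S × ℝ³`, `S` open, Oseen-mild between times of `S`,
locally bounded, slices in `L⁴`): every `t ∈ S` lies in a strip `(s₀, s₀ + T₀) ⊆ S` on which `‖u(τ)‖_{L⁴}` is uniformly bounded — the Oseen
fixed point from the bounded `L⁴` datum `u(s₀)` keeps `‖·‖₄ ≤ 2‖u(s₀)‖₄` (Lemarié-Rieusset 2016 Thm. 5.1) and is `u(· + s₀)` by uniqueness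
(KNSS 2009 §4). [folklore] -/
theorem window_L4_strip (hS : IsOpen S) (hcont : ContinuousOn (uncurry u) (S ×ˢ univ))
    (hmild : ∀ s ∈ S, ∀ t ∈ S, s < t → ∀ x,
      u t x = heatExtension (u s) (t - s) x - oseenDuhamel 1 s u u t x)
    (hbdd : ∀ τ ∈ S, ∃ B : ℝ, ∀ t ∈ S, t ≤ τ → ∀ x, ‖u t x‖ ≤ B)
    (h4 : ∀ τ ∈ S, MemLp (u τ) 4 volume) {t : ℝ} (ht : t ∈ S) :
    ∃ s₀ T₀ : ℝ, s₀ < t ∧ t < s₀ + T₀ ∧ Ioo s₀ (s₀ + T₀) ⊆ S ∧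
      ∃ M₄ : ℝ≥0, ∀ τ ∈ Ioo s₀ (s₀ + T₀), eLpNorm (u τ) 4 volume ≤ M₄ := by
  -- a ball of times around `t` inside `S`, and a sup bound up to `t + ρ/2`
  obtain ⟨ρ, hρ, hball⟩ := Metric.isOpen_iff.1 hS t ht
  have hmemS : ∀ τ : ℝ, t - ρ < τ → τ < t + ρ → τ ∈ S := fun τ h1 h2 =>
    hball (by rw [Metric.mem_ball, Real.dist_eq, abs_lt]; constructor <;> linarith)
  have hτs : t + ρ / 2 ∈ S := hmemS _ (by linarith) (by linarith)
  obtain ⟨B, hB⟩ := hbdd (t + ρ / 2) hτs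
  set A : ℝ := max B 1 with hA_def
  have hA : 0 < A := lt_of_lt_of_le one_pos (le_max_right _ _)
  have hBA : B ≤ A := le_max_left _ _
  -- the Picard constant and lifespan
  obtain ⟨C, hC, hP⟩ := exists_oseen_fixedPoint_bounded (E := E3) (p := 4) (by norm_num) (by norm_num)
  set T₁ : ℝ := (1 / (16 * C * A)) ^ 2 with hT₁_def
  have hT₁ : 0 < T₁ := by positivity
  set T₀ : ℝ := min (ρ / 2) T₁ with hT₀_def
  have hT₀ : 0 < T₀ := lt_min (by linarith) hT₁
  have hT₀ρ : T₀ ≤ ρ / 2 := min_le_left _ _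
  have hT₀T₁ : T₀ ≤ T₁ := min_le_right _ _
  set δ : ℝ := T₀ / 2 with hδ_def
  have hδ : 0 < δ := by positivity
  have hδT₀ : δ < T₀ := by rw [hδ_def]; linarith
  set s₀ : ℝ := t - δ with hs₀_def
  have hs₀S : s₀ ∈ S := hmemS _ (by rw [hs₀_def]; linarith) (by rw [hs₀_def]; linarith)
  have hIooS : ∀ τ ∈ Ioo s₀ (s₀ + T₀), τ ∈ S ∧ τ ≤ t + ρ / 2 := fun τ hτ => by
    have h1 : t - ρ < τ := by have := hτ.1; rw [hs₀_def] at this; linarith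
    have h2 : τ < t + ρ / 2 := by have := hτ.2; rw [hs₀_def] at this; linarith
    exact ⟨hmemS τ h1 (by linarith), h2.le⟩
  -- the datum
  have hslice : ∀ τ ∈ S, Continuous (u τ) := fun τ hτ =>
    hcont.comp_continuous (continuous_const.prodMk continuous_id) fun x => ⟨hτ, mem_univ _⟩
  have ha_meas : AEStronglyMeasurable (u s₀) volume := (hslice s₀ hs₀S).aestronglyMeasurable
  have ha_bd : ∀ x, ‖u s₀ x‖ ≤ A := fun x =>
    (hB s₀ hs₀S (by rw [hs₀_def]; linarith) x).trans hBA
  have ha4 : MemLp (u s₀) 4 volume := h4 s₀ hs₀S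
  have hsmall : C * A * (1 : ℝ) ^ (-(1 / 2 : ℝ)) * (2 * Real.sqrt T₀) ≤ 1 / 8 := by
    rw [Real.one_rpow, mul_one]
    have h1 : Real.sqrt T₀ ≤ Real.sqrt T₁ := Real.sqrt_le_sqrt hT₀T₁
    have h2 : Real.sqrt T₁ = 1 / (16 * C * A) := by
      rw [hT₁_def, Real.sqrt_sq (by positivity)]
    have hCA : 0 < C * A := mul_pos hC hA
    calc C * A * (2 * Real.sqrt T₀) ≤ C * A * (2 * Real.sqrt T₁) := by gcongr
      _ = 1 / 8 := by rw [h2]; field_simp; ring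
  obtain ⟨v, hvm, hvbd, hv4, -, hveq⟩ := hP one_pos hT₀ hA ha_meas ha_bd ha4 hsmall
  -- the translate `w = u(· + s₀)` solves the same Oseen equation on `(0, T₀)`
  set w : ℝ → E3 → E3 := fun τ y => u (τ + s₀) y with hw_def
  have hshift : ∀ τ ∈ Ioo 0 T₀, τ + s₀ ∈ Ioo s₀ (s₀ + T₀) := fun τ hτ =>
    ⟨by linarith [hτ.1], by linarith [hτ.2]⟩
  have hwm : AEStronglyMeasurable (uncurry w) ((volume : Measure (ℝ × E3)).restrict (Ioo 0 T₀ ×ˢ univ)) := by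
    have hc : ContinuousOn (uncurry w) (Ioo 0 T₀ ×ˢ univ) := by
      have e : uncurry w = uncurry u ∘ fun q : ℝ × E3 => (q.1 + s₀, q.2) := by
        funext q; rfl
      rw [e]
      refine hcont.comp ((continuous_fst.add continuous_const).prodMk continuous_snd).continuousOn ?_
      rintro ⟨τ, y⟩ ⟨hτ, -⟩
      exact ⟨(hIooS _ (hshift τ hτ)).1, mem_univ _⟩
    exact hc.aestronglyMeasurable (measurableSet_Ioo.prod MeasurableSet.univ)
  have hwM : ∀ τ ∈ Ioo 0 T₀, ∀ y, ‖w τ y‖ ≤ 2 * A := fun τ hτ y => by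
    have h := hB (τ + s₀) (hIooS _ (hshift τ hτ)).1 (hIooS _ (hshift τ hτ)).2 y
    show ‖u (τ + s₀) y‖ ≤ 2 * A
    linarith
  have hvM : ∀ τ ∈ Ioo 0 T₀, ∀ y, ‖v τ y‖ ≤ 2 * A := hvbd
  have hw_eq : ∀ τ ∈ Ioo 0 T₀, w τ =ᵐ[volume] fun x =>
      heatExtension (u s₀) τ x - oseenDuhamel 1 0 w w τ x := fun τ hτ => by
    refine Eventually.of_forall fun x => ?_
    have h1 := hmild s₀ hs₀S (τ + s₀) (hIooS _ (hshift τ hτ)).1 (by linarith [hτ.1]) x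
    have h2 : oseenDuhamel 1 0 w w τ x = oseenDuhamel 1 s₀ u u (τ + s₀) x := by
      have := oseenDuhamel_translate 1 0 s₀ u u τ x
      rw [zero_add] at this
      exact this
    show u (τ + s₀) x = heatExtension (u s₀) τ x - oseenDuhamel 1 0 w w τ x
    rw [h2, h1, add_sub_cancel_right]
  have hv_eq : ∀ τ ∈ Ioo 0 T₀, v τ =ᵐ[volume] fun x =>
      heatExtension (u s₀) τ x - oseenDuhamel 1 0 v v τ x := fun τ hτ =>
    Eventually.of_forall fun x => by rw [hveq τ hτ x, one_mul]
  have huniq := oseenMild_bounded_unique (U := fun τ x => heatExtension (u s₀) τ x) one_pos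
    (by positivity : (0 : ℝ) ≤ 2 * A) hwm hvm hwM hvM hw_eq hv_eq
  -- the uniform `L⁴` bound
  have ha4fin : eLpNorm (u s₀) 4 volume < ⊤ := ha4.eLpNorm_lt_top
  have hne : 2 * eLpNorm (u s₀) 4 volume ≠ ⊤ := ENNReal.mul_ne_top (by norm_num) ha4fin.ne
  refine ⟨s₀, T₀, by rw [hs₀_def]; linarith, by rw [hs₀_def]; linarith, fun τ hτ => (hIooS τ hτ).1,
    (2 * eLpNorm (u s₀) 4 volume).toNNReal, fun τ hτ => ?_⟩
  rw [ENNReal.coe_toNNReal hne]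
  have hτ' : τ - s₀ ∈ Ioo 0 T₀ := ⟨by linarith [hτ.1], by linarith [hτ.2]⟩
  have e1 : u τ = w (τ - s₀) := by
    funext y; show u τ y = u (τ - s₀ + s₀) y; rw [sub_add_cancel]
  rw [e1, eLpNorm_congr_ae (huniq (τ - s₀) hτ')]
  exact hv4 (τ - s₀) hτ'

/-! ### 2. Bounds on `∂ₜu`, `Du`, `D²u` at a time of the window (KNSS smoothing) -/

/-- **KNSS bounds at a time of a bounded mild window** (KNSS 2009, Prop. 4.1, the tree's `knss2009_smoothing_holds`, on a strip
`(s, T') ∋ t` restarted from the bounded datum `u(s)`; at the fixed time `t` the parabolic weights `(t − s)^{k/2+l}` are constants):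
there is `K` with `‖∂ₜu(t, x)‖ ≤ K`, `‖Du(t)(x)‖ ≤ K` and `‖D²u(t)(x)‖ ≤ K` for all `x`.
[cite: KochNadirashviliSereginSverak2009, Prop. 4.1 (arXiv:0709.3599 p. 8)] -/
theorem window_knss_bounds (hS : IsOpen S) (hcont : ContinuousOn (uncurry u) (S ×ˢ univ))
    (hmild : ∀ s ∈ S, ∀ t ∈ S, s < t → ∀ x,
      u t x = heatExtension (u s) (t - s) x - oseenDuhamel 1 s u u t x)
    (hbdd : ∀ τ ∈ S, ∃ B : ℝ, ∀ t ∈ S, t ≤ τ → ∀ x, ‖u t x‖ ≤ B) {t : ℝ} (ht : t ∈ S) :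
    ∃ K : ℝ, ∀ x, ‖deriv (fun τ => u τ x) t‖ ≤ K ∧ ‖fderiv ℝ (u t) x‖ ≤ K ∧
      ‖iteratedFDeriv ℝ 2 (u t) x‖ ≤ K := by
  obtain ⟨ρ, hρ, hball⟩ := Metric.isOpen_iff.1 hS t ht
  have hmemS : ∀ τ : ℝ, t - ρ < τ → τ < t + ρ → τ ∈ S := fun τ h1 h2 =>
    hball (by rw [Metric.mem_ball, Real.dist_eq, abs_lt]; constructor <;> linarith)
  set s : ℝ := t - ρ / 2 with hs_def
  set T' : ℝ := t + ρ / 2 with hT'_def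
  have hst : s < t := by rw [hs_def]; linarith
  have htT' : t < T' := by rw [hT'_def]; linarith
  have hsS : s ∈ S := hmemS s (by rw [hs_def]; linarith) (by rw [hs_def]; linarith)
  have hT'S : T' ∈ S := hmemS T' (by rw [hT'_def]; linarith) (by rw [hT'_def]; linarith)
  have hIoo : Ioo s T' ⊆ S := fun τ hτ =>
    hmemS τ (by have := hτ.1; rw [hs_def] at this; linarith) (by have := hτ.2; rw [hT'_def] at this; linarith)
  obtain ⟨B, hB⟩ := hbdd T' hT'S
  have hM0 : (0 : ℝ) ≤ max B 0 := le_max_right _ _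
  have hbound : ∀ τ ∈ S, τ ≤ T' → ∀ x, ‖u τ x‖ ≤ max B 0 :=
    fun τ hτ hle x => (hB τ hτ hle x).trans (le_max_left _ _)
  have hslice : ∀ τ ∈ S, Continuous (u τ) := fun τ hτ =>
    hcont.comp_continuous (continuous_const.prodMk continuous_id) fun x => ⟨hτ, mem_univ _⟩
  have ha : AEStronglyMeasurable (u s) volume := (hslice s hsS).aestronglyMeasurable
  have haM : eLpNorm (u s) ⊤ volume ≤ ENNReal.ofReal (max B 0) := by
    rw [eLpNorm_exponent_top]
    exact eLpNormEssSup_le_of_ae_bound (Eventually.of_forall fun x => hbound s hsS (hst.le.trans htT'.le) x)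
  have hum : AEStronglyMeasurable (uncurry u) (volume.restrict (Ioo s T' ×ˢ univ)) :=
    (hcont.mono (prod_mono hIoo Subset.rfl)).aestronglyMeasurable (measurableSet_Ioo.prod MeasurableSet.univ)
  have huM : ∀ τ ∈ Ioo s T', eLpNorm (u τ) ⊤ volume ≤ ENNReal.ofReal (max B 0) := fun τ hτ => by
    rw [eLpNorm_exponent_top]
    exact eLpNormEssSup_le_of_ae_bound (Eventually.of_forall fun x => hbound τ (hIoo hτ) hτ.2.le x)
  have husol : ∀ τ ∈ Ioo s T', u τ =ᵐ[volume] fun x =>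
      heatExtension (u s) (1 * (τ - s)) x - oseenDuhamel 1 s u u τ x := fun τ hτ =>
    Eventually.of_forall fun x => by rw [one_mul]; exact hmild s hsS τ (hIoo hτ) hτ.1 x
  obtain ⟨-, -, hbounds⟩ := knss2009_smoothing_holds E3 one_pos (hst.trans htT') hM0 ha haM hum huM husol
  have hWu : ∀ τ ∈ Ioo s T', ∀ y,
      heatExtension (u s) (1 * (τ - s)) y - oseenDuhamel 1 s u u τ y = u τ y := fun τ hτ y => by
    rw [one_mul]; exact (hmild s hsS τ (hIoo hτ) hτ.1 y).symm
  have htI : t ∈ Ioo s T' := ⟨hst, htT'⟩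
  have key : ∀ k l : ℕ, ∃ C : ℝ, ∀ x,
      ‖iteratedFDeriv ℝ k (fun y => iteratedDeriv l (fun τ' => u τ' y) t) x‖ ≤ C := by
    intro k l
    obtain ⟨C, hC⟩ := hbounds k l
    have hw : 0 < (t - s) ^ ((k : ℝ) / 2 + l) := Real.rpow_pos_of_pos (by linarith) _
    refine ⟨C / (t - s) ^ ((k : ℝ) / 2 + l), fun x => ?_⟩
    rw [le_div_iff₀ hw, mul_comm]
    have h := hC t htI x
    rwa [iteratedFDeriv_iteratedDeriv_congr isOpen_Ioo htI hWu k l x] at h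
  obtain ⟨C₁, hC₁⟩ := key 0 1
  obtain ⟨C₂, hC₂⟩ := key 1 0
  obtain ⟨C₃, hC₃⟩ := key 2 0
  have e0 : (fun y => iteratedDeriv 0 (fun τ' => u τ' y) t) = u t := by
    funext y; rw [iteratedDeriv_zero]
  refine ⟨max C₁ (max C₂ C₃), fun x => ⟨?_, ?_, ?_⟩⟩
  · have h := hC₁ x
    rw [norm_iteratedFDeriv_zero, iteratedDeriv_one] at h
    exact h.trans (le_max_left _ _)
  · have h := hC₂ x
    rw [e0] at h
    have e1 : ‖fderiv ℝ (u t) x‖ = ‖iteratedFDeriv ℝ (0 + 1) (u t) x‖ := by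
      rw [← norm_iteratedFDeriv_fderiv, norm_iteratedFDeriv_zero]
    rw [e1]
    exact h.trans ((le_max_left _ _).trans (le_max_right _ _))
  · have h := hC₃ x
    rw [e0] at h
    exact h.trans ((le_max_right _ _).trans (le_max_right _ _))

/-! ### 3. The pressure gauge: a classical pressure decaying at infinity at the given time -/

/-- `‖Δv(x)‖ ≤ 3 ‖D²v(x)‖` on `ℝ³` (`Δ = Σᵢ D²v(eᵢ, eᵢ)` over the standard orthonormal basis). [folklore] -/
theorem norm_laplacian_le {F : Type*} [NormedAddCommGroup F] [InnerProductSpace ℝ F] (v : E3 → F) (x : E3) :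
    ‖(Δ v) x‖ ≤ 3 * ‖iteratedFDeriv ℝ 2 v x‖ := by
  set b := EuclideanSpace.basisFun (Fin 3) ℝ
  rw [InnerProductSpace.laplacian_eq_iteratedFDeriv_orthonormalBasis v b]
  have hb : ∀ i, ‖b i‖ = 1 := fun i => b.orthonormal.1 i
  have h1 : ∀ i, ‖iteratedFDeriv ℝ 2 v x ![b i, b i]‖ ≤ ‖iteratedFDeriv ℝ 2 v x‖ := fun i => by
    have h := (iteratedFDeriv ℝ 2 v x).le_opNorm ![b i, b i]
    rw [Fin.prod_univ_two] at h
    simpa [hb i] using h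
  calc ‖∑ i, iteratedFDeriv ℝ 2 v x ![b i, b i]‖ ≤ ∑ i, ‖iteratedFDeriv ℝ 2 v x ![b i, b i]‖ := norm_sum_le _ _
    _ ≤ ∑ _i : Fin 3, ‖iteratedFDeriv ℝ 2 v x‖ := Finset.sum_le_sum fun i _ => h1 i
    _ = 3 * ‖iteratedFDeriv ℝ 2 v x‖ := by simp

/-- `‖∇f(x)‖ = ‖Df(x)‖` (the Riesz isometry). [folklore] -/
theorem norm_gradient_eq (f : E3 → ℝ) (x : E3) : ‖gradient f x‖ = ‖fderiv ℝ f x‖ := by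
  unfold gradient
  exact LinearIsometryEquiv.norm_map _ _

/-- The gradient ignores additive constants. [folklore] -/
theorem gradient_sub_const (f : E3 → ℝ) (c : ℝ) (x : E3) : gradient (fun y => f y - c) x = gradient f x := by
  unfold gradient
  rw [fderiv_sub_const]

/-- **THE PRESSURE GAUGE OF A BOUNDED MILD WINDOW WITH `L⁴` SLICES.**  Let `u` be continuous on `S × ℝ³` (`S` open) with divergence-free
slices, Oseen-mild between any two times of `S`, bounded on every initial segment of `S`, and with slices in `L⁴`.  Then every `t ∈ S` lies
in a strip `(s, T₂) ⊆ S` carrying a classical pressure `p` (`IsClassicalNSSolutionOn (Ioo s T₂) 1 0 u p`) whose slice at `t` DECAYS AT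
INFINITY, `p(t) → 0` along `cocompact ℝ³`.  Assembly of tree facts: Fabes–Jones–Rivière (`exists_isClassicalNSSolutionOn_Ioo`, qj-p1) gives
a classical pressure `π` on a strip; `L⁴` persistence (`window_L4_strip`) and Tao's normalisation in `L⁴ × L²`
(`PressureNormalisation.exists_pressure_ae_eq_rieszPressure_add_const`, Tao 2011 Lemma 4.1 (i) / Chae–Wolf 2017 (2.4b)) give
`π(t) = Q + C` a.e. with `Q ∈ L²`; the KNSS bounds (`window_knss_bounds`) and the momentum equation bound `∇π(t) = Δu − (u·∇)u − ∂ₜu`,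
so `π(t) − C` is Lipschitz and square integrable, hence `→ 0` at infinity (`tendsto_cocompact_of_lipschitzWith_of_integrable_sq`);
`p := π − C`. [cite: Tao2011, Lemma 4.1 (i); KochNadirashviliSereginSverak2009, Prop. 4.1] -/
theorem exists_classical_decaying_pressure (hS : IsOpen S) (hcont : ContinuousOn (uncurry u) (S ×ˢ univ))
    (hdiv : ∀ t ∈ S, VectorCalculus.IsDivFree (u t))
    (hmild : ∀ s ∈ S, ∀ t ∈ S, s < t → ∀ x,
      u t x = heatExtension (u s) (t - s) x - oseenDuhamel 1 s u u t x)
    (hbdd : ∀ τ ∈ S, ∃ B : ℝ, ∀ t ∈ S, t ≤ τ → ∀ x, ‖u t x‖ ≤ B)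
    (h4 : ∀ τ ∈ S, MemLp (u τ) 4 volume) {t : ℝ} (ht : t ∈ S) :
    ∃ s T₂ : ℝ, s < t ∧ t < T₂ ∧ Ioo s T₂ ⊆ S ∧ ∃ p : ℝ → E3 → ℝ,
      IsClassicalNSSolutionOn (Ioo s T₂) 1 0 u p ∧ Tendsto (p t) (cocompact E3) (𝓝 0) := by
  -- a classical pressure on a strip (FJR)
  obtain ⟨s₁, T₁, hs₁, hT₁, hsub₁, π, hcl⟩ := exists_isClassicalNSSolutionOn_Ioo hS hcont hdiv hmild hbdd ht
  -- a uniform `L⁴` bound on a strip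
  obtain ⟨s₀, T₀, hs₀, hT₀, hsub₀, M₄, hM₄⟩ := window_L4_strip hS hcont hmild hbdd h4 ht
  -- the common strip `J`
  set s : ℝ := max s₀ s₁ with hs_def
  set T₂ : ℝ := min (s₀ + T₀) T₁ with hT₂_def
  have hst : s < t := max_lt hs₀ hs₁
  have htT : t < T₂ := lt_min hT₀ hT₁
  have htJ : t ∈ Ioo s T₂ := ⟨hst, htT⟩
  have hJ₁ : Ioo s T₂ ⊆ Ioo s₁ T₁ := Ioo_subset_Ioo (le_max_right _ _) (min_le_right _ _)
  have hJ₀ : Ioo s T₂ ⊆ Ioo s₀ (s₀ + T₀) := Ioo_subset_Ioo (le_max_left _ _) (min_le_left _ _)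
  have hJS : Ioo s T₂ ⊆ S := hJ₁.trans hsub₁
  have hclJ : IsClassicalNSSolutionOn (Ioo s T₂) 1 0 u π := hcl.mono hJ₁ isOpen_Ioo.uniqueDiffOn
  -- Tao's normalisation in `L⁴ × L²`
  have e4 : ENNReal.ofReal (4 : ℝ) = 4 := by norm_num
  have hL4 : ∀ τ ∈ Ioo s T₂, MemLp (u τ) (ENNReal.ofReal 4) volume := fun τ hτ => by
    rw [e4]; exact h4 τ (hJS hτ)
  have hM : ∀ τ ∈ Ioo s T₂, eLpNorm (u τ) (ENNReal.ofReal 4) volume ≤ M₄ := fun τ hτ => by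
    rw [e4]; exact hM₄ τ (hJ₀ hτ)
  obtain ⟨Cq, hCq⟩ := PressureNormalisation.exists_pressure_ae_eq_rieszPressure_add_const zero_le_one hclJ
    (by norm_num : (2 : ℝ) < 4) hL4 hM
  obtain ⟨Q, hQ, -, -, C, hC⟩ := hCq t htJ
  have e2 : ENNReal.ofReal ((4 : ℝ) / 2) = 2 := by norm_num
  rw [e2] at hQ
  -- the gradient of `π(t)` is bounded (momentum equation + KNSS bounds)
  obtain ⟨K, hK⟩ := window_knss_bounds hS hcont hmild hbdd ht
  obtain ⟨B, hB⟩ := hbdd t ht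
  have hgradeq : ∀ x, gradient (π t) x = (Δ (u t)) x - convect (u t) (u t) x - deriv (fun τ => u τ x) t := by
    intro x
    have e := congrFun (timeDerivWithin_velocity_eq hclJ htJ) x
    rw [timeDerivWithin_eq_deriv isOpen_Ioo htJ] at e
    rw [e]; abel
  set L : ℝ := 3 * K + K * |B| + K with hL_def
  have hK0 : 0 ≤ K := le_trans (norm_nonneg _) (hK 0).1
  have hL0 : 0 ≤ L := by rw [hL_def]; positivity
  have hgrad : ∀ x, ‖fderiv ℝ (π t) x‖ ≤ L := by
    intro x
    obtain ⟨h1, h2, h3⟩ := hK x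
    rw [← norm_gradient_eq, hgradeq x]
    have hc : ‖convect (u t) (u t) x‖ ≤ K * |B| := by
      rw [convect_apply]
      calc ‖fderiv ℝ (u t) x (u t x)‖ ≤ ‖fderiv ℝ (u t) x‖ * ‖u t x‖ := ContinuousLinearMap.le_opNorm _ _
        _ ≤ K * |B| := by
          gcongr
          exact (hB t ht le_rfl x).trans (le_abs_self B)
    have n1 : ‖(Δ (u t)) x - convect (u t) (u t) x - deriv (fun τ => u τ x) t‖ ≤
        ‖(Δ (u t)) x - convect (u t) (u t) x‖ + ‖deriv (fun τ => u τ x) t‖ := norm_sub_le _ _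
    have n2 : ‖(Δ (u t)) x - convect (u t) (u t) x‖ ≤ ‖(Δ (u t)) x‖ + ‖convect (u t) (u t) x‖ :=
      norm_sub_le _ _
    have hΔ : ‖(Δ (u t)) x‖ ≤ 3 * K := (norm_laplacian_le (u t) x).trans (by linarith)
    rw [hL_def]
    linarith
  -- `f := π(t) − C` is Lipschitz and square integrable, hence decays
  set f : E3 → ℝ := fun x => π t x - C with hf_def
  have hπd : Differentiable ℝ (π t) := (hclJ.contDiff_pressure htJ).differentiable (by simp)
  have hLip : LipschitzWith ⟨L, hL0⟩ f := by
    refine lipschitzWith_of_nnnorm_fderiv_le (hπd.sub_const C) fun x => ?_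
    rw [← NNReal.coe_le_coe, coe_nnnorm]
    show ‖fderiv ℝ (fun y => π t y - C) x‖ ≤ L
    rw [fderiv_sub_const]
    exact hgrad x
  have hfQ : f =ᵐ[volume] Q := by
    filter_upwards [hC] with x hx
    show π t x - C = Q x
    rw [hx]; ring
  have hintQ : Integrable (fun x => ‖Q x‖ ^ 2) volume := (memLp_two_iff_integrable_sq_norm hQ.1).1 hQ
  have hint : Integrable (fun x => ‖f x‖ ^ 2) volume :=
    hintQ.congr (by filter_upwards [hfQ] with x hx; rw [hx])
  have hdec : Tendsto f (cocompact E3) (𝓝 0) := tendsto_cocompact_of_lipschitzWith_of_integrable_sq hLip hint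
  -- the re-gauged pressure
  refine ⟨s, T₂, hst, htT, hJS, fun τ x => π τ x - C, ?_, hdec⟩
  exact
    { smooth_velocity := hclJ.smooth_velocity
      smooth_pressure := by
        show ContDiffOn ℝ ∞ (fun q : ℝ × E3 => π q.1 q.2 - C) (Ioo s T₂ ×ˢ univ)
        exact ContDiffOn.sub hclJ.smooth_pressure contDiffOn_const
      momentum := fun τ hτ x => by
        rw [gradient_sub_const]
        exact hclJ.momentum τ hτ x
      divFree := hclJ.divFree }

end Summit.NavierStokesRegularity.NavierStokesRegularity.Theorems.UnthreadedRigidity.ThreadingJets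

end
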